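import Summits.CriticalPhenomena.PercolationContinuityZ3.Theorems.PercNearOneGluingNoHeavyLowerTailKnQuestion8CoefficientwiseAttachmentFlipWeak
import HarnessLib

/-!
# Attached sets are closed under intersection and stable under their own flips (the canonicity of `A*`)

Support file (`--supports stmt-CriticalPhenomena-4575`, closed), prover `prim-lf-2` (gen 35).  No definitions, no named facts, no sorries; standard axioms.
Memo `prim-lf-2/CW-INVOLUTION-gen35.md` §1.2, §2.1.

Setting as in …CoefficientwiseAttachmentFlipWeak (root `z`, edge set `E₀`, colouring `s ⊆ E₀`, zone `U = C_z(s) ∪ C_z(E₀ \ s)`); for a vertex set `W` write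
`I(W)` for the edges of `E₀` meeting `W`, and call `W` ATTACHED for `s` if every zone vertex `w' ∉ W ∪ {z}` joined to `W` by an `E₀`-edge lies in
`C_z(s \ I(W)) ∩ C_z((E₀ \ s) \ I(W))`.  The residue identity for the point row (memo §2) uses the canonical set `A*(s)` = the smallest attached set
containing the lobe of `w`; its existence and its invariance under the flip `s ↦ s ∆ I(A*)` rest on the two facts of this file:
* `Coefficientwise.attached_inter` — if `W₁` and `W₂` are attached for `s` then so is `W₁ ∩ W₂` (a neighbour outside `W₁ ∩ W₂` is outside `W₁` or outside
  `W₂`, and reachability without `I(W₁)` or without `I(W₂)` implies reachability without `I(W₁ ∩ W₂)`);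
* `Coefficientwise.attached_flip_iff` — if `A` is attached for `s`, `z ∉ A` and `B ⊆ A`, then `B` is attached for `s ∆ I(A)` iff it is attached for `s`.
  Proof: in the multigraph with the edges `I(B)` deleted, the colourings `s \ I(B)` and `(s ∆ I(A)) \ I(B)` differ exactly on the edges meeting `A \ B`,
  and `A \ B` satisfies the weak attachment hypothesis there; so (…AttachmentFlipWeak) the two clusters of `z` computed without `I(B)` are exchanged inside
  `A \ B` and unchanged outside — and the attachment condition of `B` asks for BOTH colours at each attachment vertex, a symmetric requirement.
[cite: KozmaNitzan2024, Questions 8–9 (§5.5 p. 36) (context: the Question-8 pocket covariance programme)]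
-/

namespace Summit.CriticalPhenomena.PercolationContinuityZ3.Theorems

open Finset Literature.Probability.Percolation
open scoped symmDiff

namespace Coefficientwise

variable {ι V : Type*}

open Classical in
/-- **Attached sets are closed under intersection.** [cite: KozmaNitzan2024, §5.5 (context only)] -/
theorem attached_inter (ends : ι → Sym2 V) {E₀ s : Finset ι} {z : V} (W₁ W₂ : Set V)
    (h₁ : ∀ w ∈ W₁, ∀ i ∈ E₀, ∀ w', ends i = s(w, w') →
      (w' ∈ openCluster (ends '' (↑s : Set ι)) z ∨ w' ∈ openCluster (ends '' (↑(E₀ \ s) : Set ι)) z) → w' ≠ z → w' ∉ W₁ →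
        w' ∈ openCluster (ends '' (↑(s \ E₀.filter (fun i => ∃ w, w ∈ W₁ ∧ w ∈ ends i)) : Set ι)) z ∧
        w' ∈ openCluster (ends '' (↑((E₀ \ s) \ E₀.filter (fun i => ∃ w, w ∈ W₁ ∧ w ∈ ends i)) : Set ι)) z)
    (h₂ : ∀ w ∈ W₂, ∀ i ∈ E₀, ∀ w', ends i = s(w, w') →
      (w' ∈ openCluster (ends '' (↑s : Set ι)) z ∨ w' ∈ openCluster (ends '' (↑(E₀ \ s) : Set ι)) z) → w' ≠ z → w' ∉ W₂ →
        w' ∈ openCluster (ends '' (↑(s \ E₀.filter (fun i => ∃ w, w ∈ W₂ ∧ w ∈ ends i)) : Set ι)) z ∧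
        w' ∈ openCluster (ends '' (↑((E₀ \ s) \ E₀.filter (fun i => ∃ w, w ∈ W₂ ∧ w ∈ ends i)) : Set ι)) z) :
    ∀ w ∈ W₁ ∩ W₂, ∀ i ∈ E₀, ∀ w', ends i = s(w, w') →
      (w' ∈ openCluster (ends '' (↑s : Set ι)) z ∨ w' ∈ openCluster (ends '' (↑(E₀ \ s) : Set ι)) z) → w' ≠ z → w' ∉ W₁ ∩ W₂ →
        w' ∈ openCluster (ends '' (↑(s \ E₀.filter (fun i => ∃ w, w ∈ W₁ ∩ W₂ ∧ w ∈ ends i)) : Set ι)) z ∧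
        w' ∈ openCluster (ends '' (↑((E₀ \ s) \ E₀.filter (fun i => ∃ w, w ∈ W₁ ∩ W₂ ∧ w ∈ ends i)) : Set ι)) z := by
  intro w hw i hi w' he hU hne hnW
  -- removing fewer edges keeps more of each cluster
  have mono : ∀ (W : Set V) (t : Finset ι), W₁ ∩ W₂ ⊆ W →
      openCluster (ends '' (↑(t \ E₀.filter (fun i => ∃ w, w ∈ W ∧ w ∈ ends i)) : Set ι)) z ⊆
        openCluster (ends '' (↑(t \ E₀.filter (fun i => ∃ w, w ∈ W₁ ∩ W₂ ∧ w ∈ ends i)) : Set ι)) z := by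
    intro W t hW
    refine openCluster_image_mono ends ?_ z
    intro j hj
    rw [Finset.mem_sdiff] at hj ⊢
    refine ⟨hj.1, fun hj' => hj.2 ?_⟩
    rw [Finset.mem_filter] at hj' ⊢
    obtain ⟨hjE, v, hv, hvj⟩ := hj'
    exact ⟨hjE, v, hW hv, hvj⟩
  rcases not_and_or.mp (show ¬ (w' ∈ W₁ ∧ w' ∈ W₂) from hnW) with hn1 | hn2
  · have h := h₁ w hw.1 i hi w' he hU hne hn1
    exact ⟨mono W₁ s Set.inter_subset_left h.1, mono W₁ (E₀ \ s) Set.inter_subset_left h.2⟩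
  · have h := h₂ w hw.2 i hi w' he hU hne hn2
    exact ⟨mono W₂ s Set.inter_subset_right h.1, mono W₂ (E₀ \ s) Set.inter_subset_right h.2⟩

open Classical in
/-- **Attachment is stable under the flip of a larger attached set.**  If `A` is attached for `s` (`s ⊆ E₀`, `z ∉ A`) and `B ⊆ A`, then `B` is
attached for `s ∆ I(A)` iff `B` is attached for `s`. [cite: KozmaNitzan2024, §5.5 (context only)] -/
theorem attached_flip_iff (ends : ι → Sym2 V) {E₀ s : Finset ι} {z : V} (hs : s ⊆ E₀) (A B : Set V) (hzA : z ∉ A) (hBA : B ⊆ A)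
    (hA : ∀ w ∈ A, ∀ i ∈ E₀, ∀ w', ends i = s(w, w') →
      (w' ∈ openCluster (ends '' (↑s : Set ι)) z ∨ w' ∈ openCluster (ends '' (↑(E₀ \ s) : Set ι)) z) → w' ≠ z → w' ∉ A →
        w' ∈ openCluster (ends '' (↑(s \ E₀.filter (fun i => ∃ w, w ∈ A ∧ w ∈ ends i)) : Set ι)) z ∧
        w' ∈ openCluster (ends '' (↑((E₀ \ s) \ E₀.filter (fun i => ∃ w, w ∈ A ∧ w ∈ ends i)) : Set ι)) z) :
    (∀ w ∈ B, ∀ i ∈ E₀, ∀ w', ends i = s(w, w') →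
      (w' ∈ openCluster (ends '' (↑(s ∆ E₀.filter (fun i => ∃ w, w ∈ A ∧ w ∈ ends i)) : Set ι)) z ∨
        w' ∈ openCluster (ends '' (↑(E₀ \ (s ∆ E₀.filter (fun i => ∃ w, w ∈ A ∧ w ∈ ends i))) : Set ι)) z) → w' ≠ z → w' ∉ B →
        w' ∈ openCluster (ends '' (↑((s ∆ E₀.filter (fun i => ∃ w, w ∈ A ∧ w ∈ ends i)) \ E₀.filter (fun i => ∃ w, w ∈ B ∧ w ∈ ends i)) : Set ι)) z ∧
        w' ∈ openCluster (ends '' (↑((E₀ \ (s ∆ E₀.filter (fun i => ∃ w, w ∈ A ∧ w ∈ ends i))) \ E₀.filter (fun i => ∃ w, w ∈ B ∧ w ∈ ends i)) : Set ι)) z)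
    ↔
    (∀ w ∈ B, ∀ i ∈ E₀, ∀ w', ends i = s(w, w') →
      (w' ∈ openCluster (ends '' (↑s : Set ι)) z ∨ w' ∈ openCluster (ends '' (↑(E₀ \ s) : Set ι)) z) → w' ≠ z → w' ∉ B →
        w' ∈ openCluster (ends '' (↑(s \ E₀.filter (fun i => ∃ w, w ∈ B ∧ w ∈ ends i)) : Set ι)) z ∧
        w' ∈ openCluster (ends '' (↑((E₀ \ s) \ E₀.filter (fun i => ∃ w, w ∈ B ∧ w ∈ ends i)) : Set ι)) z) := by
  set IA : Finset ι := E₀.filter (fun i => ∃ w, w ∈ A ∧ w ∈ ends i) with hIA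
  set IB : Finset ι := E₀.filter (fun i => ∃ w, w ∈ B ∧ w ∈ ends i) with hIB
  have memIA : ∀ {i : ι}, i ∈ IA ↔ i ∈ E₀ ∧ ∃ w, w ∈ A ∧ w ∈ ends i := fun {i} => by rw [hIA, Finset.mem_filter]
  have memIB : ∀ {i : ι}, i ∈ IB ↔ i ∈ E₀ ∧ ∃ w, w ∈ B ∧ w ∈ ends i := fun {i} => by rw [hIB, Finset.mem_filter]
  have hIBA : IB ⊆ IA := by
    intro i hi
    obtain ⟨hiE, w, hw, hwi⟩ := memIB.mp hi
    exact memIA.mpr ⟨hiE, w, hBA hw, hwi⟩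
  have hIAE : IA ⊆ E₀ := Finset.filter_subset _ _
  -- the zone is unchanged by the flip of `A`
  have hU := union_flip_eq_attachment ends hs A hzA hA
  -- the auxiliary multigraph `E₁ = E₀ \ IB` with colouring `s₁ = s \ IB` and flipped set `A \ B`
  set E₁ : Finset ι := E₀ \ IB with hE₁
  set s₁ : Finset ι := s \ IB with hs₁
  have hs₁E₁ : s₁ ⊆ E₁ := by
    intro i hi
    rw [hs₁, Finset.mem_sdiff] at hi
    exact Finset.mem_sdiff.mpr ⟨hs hi.1, hi.2⟩
  set J : Finset ι := E₁.filter (fun i => ∃ w, w ∈ A \ B ∧ w ∈ ends i) with hJ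
  have memJ : ∀ {i : ι}, i ∈ J ↔ i ∈ E₁ ∧ ∃ w, w ∈ A \ B ∧ w ∈ ends i := fun {i} => by rw [hJ, Finset.mem_filter]
  -- `J = IA \ IB`
  have hJeq : ∀ i, i ∈ J ↔ i ∈ IA ∧ i ∉ IB := by
    intro i
    constructor
    · intro hi
      obtain ⟨hiE₁, w, hw, hwi⟩ := memJ.mp hi
      rw [hE₁, Finset.mem_sdiff] at hiE₁
      exact ⟨memIA.mpr ⟨hiE₁.1, w, hw.1, hwi⟩, hiE₁.2⟩
    · rintro ⟨hiA, hiB⟩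
      obtain ⟨hiE, w, hw, hwi⟩ := memIA.mp hiA
      have hwB : w ∉ B := fun h => hiB (memIB.mpr ⟨hiE, w, h, hwi⟩)
      exact memJ.mpr ⟨by rw [hE₁]; exact Finset.mem_sdiff.mpr ⟨hiE, hiB⟩, w, ⟨hw, hwB⟩, hwi⟩
  -- bookkeeping identities between the edge sets
  have e1 : s₁ ∆ J = (s ∆ IA) \ IB := by
    ext i
    simp only [Finset.mem_symmDiff, Finset.mem_sdiff, hJeq i, hs₁]
    constructor
    · rintro (⟨⟨his, hiB⟩, hnJ⟩ | ⟨⟨hiA, hiB⟩, hn⟩)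
      · exact ⟨Or.inl ⟨his, fun hiA => hnJ ⟨hiA, hiB⟩⟩, hiB⟩
      · exact ⟨Or.inr ⟨hiA, fun his => hn ⟨his, hiB⟩⟩, hiB⟩
    · rintro ⟨⟨his, hniA⟩ | ⟨hiA, hnis⟩, hiB⟩
      · exact Or.inl ⟨⟨his, hiB⟩, fun h => hniA h.1⟩
      · exact Or.inr ⟨⟨hiA, hiB⟩, fun h => hnis h.1⟩
  have e2 : E₁ \ s₁ = (E₀ \ s) \ IB := by
    ext i
    simp only [hE₁, hs₁, Finset.mem_sdiff, not_and, not_not]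
    constructor
    · rintro ⟨⟨hiE, hiB⟩, h⟩
      exact ⟨⟨hiE, fun his => hiB (h his)⟩, hiB⟩
    · rintro ⟨⟨hiE, hnis⟩, hiB⟩
      exact ⟨⟨hiE, hiB⟩, fun his => absurd his hnis⟩
  have e3 : E₁ \ (s₁ ∆ J) = (E₀ \ (s ∆ IA)) \ IB := by
    rw [e1]
    ext i
    simp only [hE₁, Finset.mem_sdiff, not_and, not_not]
    constructor
    · rintro ⟨⟨hiE, hiB⟩, h⟩
      exact ⟨⟨hiE, fun hi' => hiB (h hi')⟩, hiB⟩
    · rintro ⟨⟨hiE, hn⟩, hiB⟩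
      exact ⟨⟨hiE, hiB⟩, fun h => absurd h hn⟩
  have e4 : s₁ \ J = s \ IA := by
    ext i
    simp only [hs₁, Finset.mem_sdiff, hJeq i, not_and, not_not]
    constructor
    · rintro ⟨⟨his, hiB⟩, h⟩
      exact ⟨his, fun hiA => hiB (h hiA)⟩
    · rintro ⟨his, hniA⟩
      exact ⟨⟨his, fun hiB => hniA (hIBA hiB)⟩, fun hiA => absurd hiA hniA⟩
  have e5 : (E₁ \ s₁) \ J = (E₀ \ s) \ IA := by
    rw [e2]
    ext i
    simp only [Finset.mem_sdiff, hJeq i, not_and, not_not]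
    constructor
    · rintro ⟨⟨h, hiB⟩, h'⟩
      exact ⟨h, fun hiA => hiB (h' hiA)⟩
    · rintro ⟨h, hniA⟩
      exact ⟨⟨h, fun hiB => hniA (hIBA hiB)⟩, fun hiA => absurd hiA hniA⟩
  -- zone of the auxiliary graph is inside the zone
  have zone₁ : ∀ v, (v ∈ openCluster (ends '' (↑s₁ : Set ι)) z ∨ v ∈ openCluster (ends '' (↑(E₁ \ s₁) : Set ι)) z) →
      (v ∈ openCluster (ends '' (↑s : Set ι)) z ∨ v ∈ openCluster (ends '' (↑(E₀ \ s) : Set ι)) z) := by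
    intro v hv
    rcases hv with h | h
    · exact Or.inl (openCluster_image_mono ends (by rw [hs₁]; exact Finset.sdiff_subset) z h)
    · rw [e2] at h
      exact Or.inr (openCluster_image_mono ends Finset.sdiff_subset z h)
  -- `A \ B` satisfies the weak attachment hypothesis in the auxiliary graph
  have hzAB : z ∉ A \ B := fun h => hzA h.1
  have hWa₁ : ∀ w ∈ A \ B, ∀ i ∈ E₁, ∀ w', ends i = s(w, w') →
      (w' ∈ openCluster (ends '' (↑s₁ : Set ι)) z ∨ w' ∈ openCluster (ends '' (↑(E₁ \ s₁) : Set ι)) z) → w' ≠ z → w' ∉ A \ B →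
        w' ∈ openCluster (ends '' (↑(s₁ \ E₁.filter (fun i => ∃ w, w ∈ A \ B ∧ w ∈ ends i)) : Set ι)) z ∧
        w' ∈ openCluster (ends '' (↑((E₁ \ s₁) \ E₁.filter (fun i => ∃ w, w ∈ A \ B ∧ w ∈ ends i)) : Set ι)) z := by
    intro w hw i hi w' he hU₁ hne hnAB
    have hiE : i ∈ E₀ := by rw [hE₁, Finset.mem_sdiff] at hi; exact hi.1
    have hiB : i ∉ IB := by rw [hE₁, Finset.mem_sdiff] at hi; exact hi.2
    have hw'B : w' ∉ B := by
      intro h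
      exact hiB (memIB.mpr ⟨hiE, w', h, by rw [he]; exact Sym2.mem_mk_right w w'⟩)
    have hw'A : w' ∉ A := fun h => hnAB ⟨h, hw'B⟩
    have h := hA w hw.1 i hiE w' he (zone₁ w' hU₁) hne hw'A
    rw [← hJ, e4, e5]
    exact h
  have red := mem_openCluster_flip_iff_attachment ends hs₁E₁ (A \ B) hzAB hWa₁
  have blue := mem_openCluster_sdiff_flip_iff_attachment ends hs₁E₁ (A \ B) hzAB hWa₁
  -- reachability without `IB`, before and after the flip of `A`
  have key : ∀ v, v ≠ z →
      ((v ∈ openCluster (ends '' (↑((s ∆ IA) \ IB) : Set ι)) z ∧ v ∈ openCluster (ends '' (↑((E₀ \ (s ∆ IA)) \ IB) : Set ι)) z) ↔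
       (v ∈ openCluster (ends '' (↑(s \ IB) : Set ι)) z ∧ v ∈ openCluster (ends '' (↑((E₀ \ s) \ IB) : Set ι)) z)) := by
    intro v hvz
    have r := red v
    have b := blue v
    rw [← hJ, e1] at r
    rw [← hJ, e3, e2] at b
    rw [← hs₁, r, b]
    by_cases hvAB : v ∈ A \ B
    · constructor
      · rintro ⟨h1, h2⟩
        rcases h1 with h | ⟨-, hn⟩ | ⟨-, h1'⟩
        · exact absurd h hvz
        · exact absurd hvAB hn
        rcases h2 with h | ⟨-, hn⟩ | ⟨-, h2'⟩
        · exact absurd h hvz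
        · exact absurd hvAB hn
        rw [e2] at h1'
        exact ⟨h2', h1'⟩
      · rintro ⟨h1, h2⟩
        rw [← e2] at h2
        exact ⟨Or.inr (Or.inr ⟨hvAB, h2⟩), Or.inr (Or.inr ⟨hvAB, h1⟩)⟩
    · constructor
      · rintro ⟨h1, h2⟩
        rcases h1 with h | ⟨h1', -⟩ | ⟨hv, -⟩
        · exact absurd h hvz
        rcases h2 with h | ⟨h2', -⟩ | ⟨hv, -⟩
        · exact absurd h hvz
        · exact ⟨h1', h2'⟩
        · exact absurd hv hvAB
        · exact absurd hv hvAB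
      · rintro ⟨h1, h2⟩
        exact ⟨Or.inr (Or.inl ⟨h1, hvAB⟩), Or.inr (Or.inl ⟨h2, hvAB⟩)⟩
  constructor
  · intro h w hw i hi w' he hUw hne hnB
    have hUw' : w' ∈ openCluster (ends '' (↑(s ∆ IA) : Set ι)) z ∨ w' ∈ openCluster (ends '' (↑(E₀ \ (s ∆ IA)) : Set ι)) z := by
      have : w' ∈ openCluster (ends '' (↑(s ∆ IA) : Set ι)) z ∪ openCluster (ends '' (↑(E₀ \ (s ∆ IA)) : Set ι)) z := by
        rw [hU]; exact hUw
      exact this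
    exact (key w' hne).mp (h w hw i hi w' he hUw' hne hnB)
  · intro h w hw i hi w' he hUw hne hnB
    have hUw' : w' ∈ openCluster (ends '' (↑s : Set ι)) z ∨ w' ∈ openCluster (ends '' (↑(E₀ \ s) : Set ι)) z := by
      have : w' ∈ openCluster (ends '' (↑(s ∆ IA) : Set ι)) z ∪ openCluster (ends '' (↑(E₀ \ (s ∆ IA)) : Set ι)) z := hUw
      rw [hU] at this; exact this
    exact (key w' hne).mpr (h w hw i hi w' he hUw' hne hnB)

end Coefficientwise

end Summit.CriticalPhenomena.PercolationContinuityZ3.Theorems
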